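import Summits.PneNP.GCT.Max.KYAllMArithmetic
import Mathlib.Tactic.IntervalCases
import Mathlib.Tactic.Positivity
import Mathlib.Tactic.Linarith
import Mathlib.Tactic.Ring
import HarnessLib
import HarnessLib.Audit

/-!
# `GCT/Max`: the high-`k` arithmetic of the sharper Koszul–Young ceiling — Lemma A′ (`3m ≤ 2N`) and
# `S(m,k)·n² ≤ C(n,k+1)²` for `k ≥ 5`, `2n ≥ 3m+2`, `2k+1 ≤ n`

Cell `pub-gct-max` (HOME `run/shared/lean/pub/pub-gct-max/`), track F, banked input P4 / W1′a (director-valiant g7, LEAD gen 31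
desk): the pure-arithmetic layer for the HIGH-`k` half of the sharper all-`m` ceiling `KYCannotSeparatePaddedPerSharper`
(module `Max/KYSharperAllM`, threshold `2n ≥ 3m+2` instead of `n ≥ 2m+2`). Written and kernel-checked by theory-2 (gen 26);
mathematics: theory-2 memo `calc33-allm/W1PRIME-NOTES.md` §7–§8 (NOT IN PRINT). Imports `Max/KYAllMArithmetic` (the partials
bound `KYAllM.chooseSqSum` and the Lemma-A toolbox) and Mathlib only; everything PROVED; no conjecture of the cell is used or
asserted. HONEST FRAMING: arithmetic lemmas serving a LOCATED NEGATIVE about ONE family of equations (plain Koszul–Young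
flattenings `Λ^p ⊗ S^k`) for padded permanents; occurrence obstructions are ruled out in print (BIP'16) — multiplicity obstructions
are the open door; nothing here is a claim on VP vs VNP or P vs NP.

**Contents.** LEMMA A′ `KYAllM.lemmaA'`: for `3m ≤ 2N`, `2k ≤ N`, `k ≥ 5`: `S(m,k)·(k+1)² ≤ C(N,k)²` — the range `k > m` by the
Catalan bound of `Max/KYAllMArithmetic`; `k ≤ m ≤ 27` by a kernel `decide` table at `N₀ = max(⌈3m/2⌉, 2k)` and monotonicity of
`C(·,k)`; for `m ≥ 28` the cases `9 ≤ k ≤ m/2` (`S ≤ (k+1)C(m,k)²`, `(k+1)³4^k ≤ 9^k`, `3^k C(m,k) ≤ 2^k C(N,k)`),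
`5 ≤ k ≤ 8` (`3S ≤ 4C(m,k)²` from `2C(m,l) ≤ C(m,l+1)` for `3l+2 ≤ m`, `4^{k+1}(k+1)² ≤ 3·9^k`) and `m/2 < k ≤ m`
(`S ≤ (k+1)C(m,⌊m/2⌋)²`, `32(j+1)³4^{j+1} ≤ 9^{j+1}` for `j = ⌊m/2⌋ ≥ 14`, `C(m,j) ≤ 2C(m,j+1)`, `3^{j+1}C(m,j+1) ≤ 2^{j+1}C(N,j+1)
≤ 2^{j+1}C(N,k)`); and the consumer form `KYAllM.highK_criterion : 5 ≤ k → 3m+2 ≤ 2n → 2k+1 ≤ n → S(m,k)·n² ≤ C(n,k+1)²`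
(`n = N+1`, `(k+1)C(n,k+1) = n·C(N,k)`), which is `KYSharper.HighKArithmetic` of `Max/KYSharperAllM`. The hypothesis `k ≥ 5` is
where the threshold `3m ≤ 2N` (instead of Lemma A's `2m+1 ≤ N`) is affordable: for `k ≤ 4` the inequality is false near
`N = ⌈3m/2⌉` and the low-`k` half (`Max/KYSharperLowK`) uses the toolkit side `Λ^{c+1} ⊗ Λ^{k+1}` instead.
-/

namespace Summit.PneNP.GCT

namespace KYAllM

open Finset

/-! ## `3^k·C(m,k) ≤ 2^k·C(N,k)` for `3m ≤ 2N` -/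

/-- `3^k · m^(k)↓ ≤ 2^k · N^(k)↓` for `3m ≤ 2N` (each factor `3(m-i) ≤ 2(N-i)`). [folklore] -/
lemma three_pow_mul_descFactorial_le (m N k : ℕ) (h : 3 * m ≤ 2 * N) :
    3 ^ k * m.descFactorial k ≤ 2 ^ k * N.descFactorial k := by
  induction k with
  | zero => simp
  | succ k ih =>
    rw [Nat.descFactorial_succ, Nat.descFactorial_succ, pow_succ, pow_succ]
    calc 3 ^ k * 3 * ((m - k) * m.descFactorial k) = (3 * (m - k)) * (3 ^ k * m.descFactorial k) := by ring
      _ ≤ (2 * (N - k)) * (2 ^ k * N.descFactorial k) := Nat.mul_le_mul (by omega) ih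
      _ = 2 ^ k * 2 * ((N - k) * N.descFactorial k) := by ring

/-- `3^k · C(m,k) ≤ 2^k · C(N,k)` for `3m ≤ 2N`. [folklore] -/
lemma three_pow_mul_choose_le (m N k : ℕ) (h : 3 * m ≤ 2 * N) : 3 ^ k * m.choose k ≤ 2 ^ k * N.choose k := by
  have h' := three_pow_mul_descFactorial_le m N k h
  rw [Nat.descFactorial_eq_factorial_mul_choose, Nat.descFactorial_eq_factorial_mul_choose] at h'
  refine Nat.le_of_mul_le_mul_left ?_ (Nat.factorial_pos k)
  calc k.factorial * (3 ^ k * m.choose k) = 3 ^ k * (k.factorial * m.choose k) := by ring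
    _ ≤ 2 ^ k * (k.factorial * N.choose k) := h'
    _ = k.factorial * (2 ^ k * N.choose k) := by ring

/-- `9^k = (3^k)²`. [folklore] -/
lemma nine_pow_eq_sq (k : ℕ) : (9 : ℕ) ^ k = (3 ^ k) ^ 2 := by
  rw [show (9 : ℕ) = 3 ^ 2 by norm_num, ← pow_mul, ← pow_mul, mul_comm]

/-! ## Numeric power inequalities -/

/-- `4(k+2)³ ≤ 9(k+1)³` for `k ≥ 9` (in fact for `k ≥ 2`). [folklore] -/
lemma four_mul_cube_succ_le (k : ℕ) (hk : 9 ≤ k) : (k + 1 + 1) ^ 3 * 4 ≤ 9 * (k + 1) ^ 3 := by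
  obtain ⟨j, rfl⟩ : ∃ j, k = j + 9 := ⟨k - 9, by omega⟩
  have e : 9 * (j + 9 + 1) ^ 3 = (j + 9 + 1 + 1) ^ 3 * 4 + (5 * j ^ 3 + 138 * j ^ 2 + 1248 * j + 3676) := by ring
  rw [e]; exact Nat.le_add_right _ _

/-- `(k+1)³ · 4^k ≤ 9^k` for `k ≥ 9`. [folklore] -/
lemma cube_mul_four_pow_le_nine_pow (k : ℕ) (hk : 9 ≤ k) : (k + 1) ^ 3 * 4 ^ k ≤ 9 ^ k := by
  induction k, hk using Nat.le_induction with
  | base => norm_num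
  | succ k hk ih =>
    calc (k + 1 + 1) ^ 3 * 4 ^ (k + 1) = ((k + 1 + 1) ^ 3 * 4) * 4 ^ k := by ring
      _ ≤ (9 * (k + 1) ^ 3) * 4 ^ k := Nat.mul_le_mul_right _ (four_mul_cube_succ_le k hk)
      _ = 9 * ((k + 1) ^ 3 * 4 ^ k) := by ring
      _ ≤ 9 * 9 ^ k := Nat.mul_le_mul_left 9 ih
      _ = 9 ^ (k + 1) := by ring

/-- `32·(j+1)³·4^(j+1) ≤ 9^(j+1)` for `j ≥ 14`. [folklore] -/
lemma thirtytwo_mul_cube_mul_four_pow_le (j : ℕ) (hj : 14 ≤ j) : 32 * (j + 1) ^ 3 * 4 ^ (j + 1) ≤ 9 ^ (j + 1) := by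
  induction j, hj using Nat.le_induction with
  | base => norm_num
  | succ j hj ih =>
    have h1 : (j + 1 + 1) ^ 3 * 4 ≤ 9 * (j + 1) ^ 3 := four_mul_cube_succ_le j (by omega)
    calc 32 * (j + 1 + 1) ^ 3 * 4 ^ (j + 1 + 1) = 32 * ((j + 1 + 1) ^ 3 * 4) * 4 ^ (j + 1) := by ring
      _ ≤ 32 * (9 * (j + 1) ^ 3) * 4 ^ (j + 1) := Nat.mul_le_mul_right _ (Nat.mul_le_mul_left 32 h1)
      _ = 9 * (32 * (j + 1) ^ 3 * 4 ^ (j + 1)) := by ring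
      _ ≤ 9 * 9 ^ (j + 1) := Nat.mul_le_mul_left 9 ih
      _ = 9 ^ (j + 1 + 1) := by ring

/-- `4^(k+1)·(k+1)² ≤ 3·9^k` for `5 ≤ k ≤ 8`. [folklore] -/
lemma four_pow_succ_mul_sq_le (k : ℕ) (h5 : 5 ≤ k) (h8 : k ≤ 8) : 4 ^ (k + 1) * (k + 1) ^ 2 ≤ 3 * 9 ^ k := by
  interval_cases k <;> norm_num

/-! ## Geometric growth of `C(m,·)` below `m/3`: `3·S(m,k) ≤ 4·C(m,k)²` -/

/-- `2·C(m,l) ≤ C(m,l+1)` for `3l+2 ≤ m` (`(l+1)C(m,l+1) = (m-l)C(m,l)` and `2(l+1) ≤ m-l`). [folklore] -/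
lemma two_mul_choose_le_choose_succ (m l : ℕ) (h : 3 * l + 2 ≤ m) : 2 * m.choose l ≤ m.choose (l + 1) := by
  have e := Nat.choose_succ_right_eq m l
  refine Nat.le_of_mul_le_mul_right ?_ (Nat.succ_pos l)
  calc 2 * m.choose l * (l + 1) = m.choose l * (2 * (l + 1)) := by ring
    _ ≤ m.choose l * (m - l) := Nat.mul_le_mul_left _ (by omega)
    _ = m.choose (l + 1) * (l + 1) := e.symm

/-- `3·S(m,k) ≤ 4·C(m,k)²` for `3k ≤ m+1`. [folklore] -/
lemma three_mul_chooseSqSum_le (m k : ℕ) (h : 3 * k ≤ m + 1) : 3 * chooseSqSum m k ≤ 4 * (m.choose k) ^ 2 := by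
  induction k with
  | zero => simp [chooseSqSum_zero]
  | succ k ih =>
    have h2 : 2 * m.choose k ≤ m.choose (k + 1) := two_mul_choose_le_choose_succ m k (by omega)
    have h4 : 4 * (m.choose k) ^ 2 ≤ (m.choose (k + 1)) ^ 2 := by
      calc 4 * (m.choose k) ^ 2 = (2 * m.choose k) ^ 2 := by ring
        _ ≤ (m.choose (k + 1)) ^ 2 := Nat.pow_le_pow_left h2 2
    rw [chooseSqSum_succ]
    calc 3 * (chooseSqSum m k + (m.choose (k + 1)) ^ 2) = 3 * chooseSqSum m k + 3 * (m.choose (k + 1)) ^ 2 := by ring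
      _ ≤ 4 * (m.choose k) ^ 2 + 3 * (m.choose (k + 1)) ^ 2 := Nat.add_le_add_right (ih (by omega)) _
      _ ≤ (m.choose (k + 1)) ^ 2 + 3 * (m.choose (k + 1)) ^ 2 := Nat.add_le_add_right h4 _
      _ = 4 * (m.choose (k + 1)) ^ 2 := by ring

/-! ## Lemma A′: the table `5 ≤ k ≤ m ≤ 27` and the three analytic regimes for `m ≥ 28` -/

/-- The table of Lemma A′ for `5 ≤ k ≤ m ≤ 27` at the least admissible `N₀ = max(⌈3m/2⌉, 2k)`, on the `decide`-friendly mirrors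
`chooseSqSumD` / `binomD` (276 entries; kernel `decide`). [folklore] -/
theorem lemmaA'_tableD : ∀ m ≤ 27, ∀ k ≤ m, 5 ≤ k →
    chooseSqSumD m k * (k + 1) ^ 2 ≤ (binomD (max ((3 * m + 1) / 2) (2 * k)) k) ^ 2 := by
  decide

/-- Lemma A′ for `5 ≤ k ≤ m ≤ 27`, `3m ≤ 2N`, `2k ≤ N` (table at `N₀ ≤ N` and `C(N₀,k) ≤ C(N,k)`). [folklore] -/
lemma lemmaA'_small (m N k : ℕ) (hm : m ≤ 27) (hkm : k ≤ m) (hk5 : 5 ≤ k) (hN : 3 * m ≤ 2 * N) (hk2 : 2 * k ≤ N) :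
    chooseSqSum m k * (k + 1) ^ 2 ≤ (N.choose k) ^ 2 := by
  have ht := lemmaA'_tableD m hm k hkm hk5
  rw [chooseSqSumD_eq, binomD_eq] at ht
  have hN0 : max ((3 * m + 1) / 2) (2 * k) ≤ N := max_le (by omega) hk2
  exact ht.trans (Nat.pow_le_pow_left (Nat.choose_le_choose k hN0) 2)

/-- Lemma A′, regime `9 ≤ k ≤ m/2`: `S ≤ (k+1)C(m,k)²`, `(k+1)³4^k ≤ 9^k`, `3^k C(m,k) ≤ 2^k C(N,k)`. [folklore] -/
lemma lemmaA'_regimeI (m N k : ℕ) (hk9 : 9 ≤ k) (hkm : k ≤ m / 2) (hN : 3 * m ≤ 2 * N) :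
    chooseSqSum m k * (k + 1) ^ 2 ≤ (N.choose k) ^ 2 := by
  have hS : chooseSqSum m k ≤ (k + 1) * (m.choose k) ^ 2 :=
    chooseSqSum_le_succ_mul m k _ fun l hl => Nat.pow_le_pow_left (choose_mono_below_half m l k hl hkm) 2
  have h3 := three_pow_mul_choose_le m N k hN
  refine Nat.le_of_mul_le_mul_left ?_ (pow_pos (by norm_num : 0 < 4) k)
  calc 4 ^ k * (chooseSqSum m k * (k + 1) ^ 2) ≤ 4 ^ k * ((k + 1) * (m.choose k) ^ 2 * (k + 1) ^ 2) :=
        Nat.mul_le_mul_left _ (Nat.mul_le_mul_right _ hS)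
    _ = ((k + 1) ^ 3 * 4 ^ k) * (m.choose k) ^ 2 := by ring
    _ ≤ 9 ^ k * (m.choose k) ^ 2 := Nat.mul_le_mul_right _ (cube_mul_four_pow_le_nine_pow k hk9)
    _ = (3 ^ k * m.choose k) ^ 2 := by rw [nine_pow_eq_sq]; ring
    _ ≤ (2 ^ k * N.choose k) ^ 2 := Nat.pow_le_pow_left h3 2
    _ = 4 ^ k * (N.choose k) ^ 2 := by rw [four_pow_eq_sq]; ring

/-- Lemma A′, regime `5 ≤ k ≤ 8`, `3k ≤ m+1`: `3S ≤ 4C(m,k)²`, `4^{k+1}(k+1)² ≤ 3·9^k`, `3^k C(m,k) ≤ 2^k C(N,k)`. [folklore] -/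
lemma lemmaA'_regimeI_small (m N k : ℕ) (hk5 : 5 ≤ k) (hk8 : k ≤ 8) (hkm : 3 * k ≤ m + 1) (hN : 3 * m ≤ 2 * N) :
    chooseSqSum m k * (k + 1) ^ 2 ≤ (N.choose k) ^ 2 := by
  have hS := three_mul_chooseSqSum_le m k hkm
  have h3 := three_pow_mul_choose_le m N k hN
  have hnum := four_pow_succ_mul_sq_le k hk5 hk8
  refine Nat.le_of_mul_le_mul_left ?_ (show 0 < 3 * 4 ^ k by positivity)
  calc 3 * 4 ^ k * (chooseSqSum m k * (k + 1) ^ 2) = 4 ^ k * (k + 1) ^ 2 * (3 * chooseSqSum m k) := by ring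
    _ ≤ 4 ^ k * (k + 1) ^ 2 * (4 * (m.choose k) ^ 2) := Nat.mul_le_mul_left _ hS
    _ = (4 ^ (k + 1) * (k + 1) ^ 2) * (m.choose k) ^ 2 := by ring
    _ ≤ (3 * 9 ^ k) * (m.choose k) ^ 2 := Nat.mul_le_mul_right _ hnum
    _ = 3 * (3 ^ k * m.choose k) ^ 2 := by rw [nine_pow_eq_sq]; ring
    _ ≤ 3 * (2 ^ k * N.choose k) ^ 2 := Nat.mul_le_mul_left 3 (Nat.pow_le_pow_left h3 2)
    _ = 3 * 4 ^ k * (N.choose k) ^ 2 := by rw [four_pow_eq_sq]; ring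

/-- Lemma A′, regime `m/2 < k ≤ m`, `m ≥ 28`, `2k ≤ N`: `S ≤ (k+1)C(m,j)²` (`j = ⌊m/2⌋`), `(k+1)³ ≤ 8(j+1)³`,
`C(m,j) ≤ 2C(m,j+1)`, `32(j+1)³4^{j+1} ≤ 9^{j+1}`, `3^{j+1}C(m,j+1) ≤ 2^{j+1}C(N,j+1) ≤ 2^{j+1}C(N,k)`. [folklore] -/
lemma lemmaA'_regimeII (m N k : ℕ) (hm : 28 ≤ m) (hjk : m / 2 < k) (hkm : k ≤ m) (hN : 3 * m ≤ 2 * N)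
    (hk2 : 2 * k ≤ N) : chooseSqSum m k * (k + 1) ^ 2 ≤ (N.choose k) ^ 2 := by
  set j := m / 2 with hj
  have hS : chooseSqSum m k ≤ (k + 1) * (m.choose j) ^ 2 :=
    chooseSqSum_le_succ_mul m k _ fun l _ => Nat.pow_le_pow_left (Nat.choose_le_middle l m) 2
  have hhalf : m.choose j ≤ 2 * m.choose (j + 1) := choose_half_le_two_mul m (by omega)
  have hnum : 32 * (j + 1) ^ 3 * 4 ^ (j + 1) ≤ 9 ^ (j + 1) := thirtytwo_mul_cube_mul_four_pow_le j (by omega)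
  have h3 : 3 ^ (j + 1) * m.choose (j + 1) ≤ 2 ^ (j + 1) * N.choose (j + 1) := three_pow_mul_choose_le m N (j + 1) hN
  have hmono : N.choose (j + 1) ≤ N.choose k := choose_mono_below_half N (j + 1) k (by omega) (by omega)
  have hk1 : k + 1 ≤ 2 * (j + 1) := by omega
  refine Nat.le_of_mul_le_mul_left ?_ (pow_pos (by norm_num : 0 < 4) (j + 1))
  calc 4 ^ (j + 1) * (chooseSqSum m k * (k + 1) ^ 2)
        ≤ 4 ^ (j + 1) * ((k + 1) * (m.choose j) ^ 2 * (k + 1) ^ 2) :=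
          Nat.mul_le_mul_left _ (Nat.mul_le_mul_right _ hS)
    _ = 4 ^ (j + 1) * (k + 1) ^ 3 * (m.choose j) ^ 2 := by ring
    _ ≤ 4 ^ (j + 1) * (2 * (j + 1)) ^ 3 * (2 * m.choose (j + 1)) ^ 2 :=
          Nat.mul_le_mul (Nat.mul_le_mul_left _ (Nat.pow_le_pow_left hk1 3)) (Nat.pow_le_pow_left hhalf 2)
    _ = (32 * (j + 1) ^ 3 * 4 ^ (j + 1)) * (m.choose (j + 1)) ^ 2 := by ring
    _ ≤ 9 ^ (j + 1) * (m.choose (j + 1)) ^ 2 := Nat.mul_le_mul_right _ hnum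
    _ = (3 ^ (j + 1) * m.choose (j + 1)) ^ 2 := by rw [nine_pow_eq_sq]; ring
    _ ≤ (2 ^ (j + 1) * N.choose (j + 1)) ^ 2 := Nat.pow_le_pow_left h3 2
    _ ≤ (2 ^ (j + 1) * N.choose k) ^ 2 := Nat.pow_le_pow_left (Nat.mul_le_mul_left _ hmono) 2
    _ = 4 ^ (j + 1) * (N.choose k) ^ 2 := by rw [four_pow_eq_sq]; ring

/-- **LEMMA A′ (threshold `3m ≤ 2N`, `k ≥ 5`).** For `3m ≤ 2N`, `2k ≤ N` and `k ≥ 5`: `S(m,k)·(k+1)² ≤ C(N,k)²`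
(`k > m`: Catalan bound; `k ≤ m ≤ 27`: table; `m ≥ 28`: regimes I (`k ≥ 9`), I-small (`5 ≤ k ≤ 8`), II (`k > m/2`)). [folklore] -/
theorem lemmaA' (m N k : ℕ) (hN : 3 * m ≤ 2 * N) (hk2 : 2 * k ≤ N) (hk5 : 5 ≤ k) :
    chooseSqSum m k * (k + 1) ^ 2 ≤ (N.choose k) ^ 2 := by
  rcases Nat.lt_or_ge m k with hmk | hmk
  · rw [chooseSqSum_of_le m k hmk.le]
    exact (centralBinom_mul_sq_le m k hmk).trans (Nat.pow_le_pow_left (Nat.choose_le_choose k hk2) 2)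
  rcases Nat.lt_or_ge m 28 with hm | hm
  · exact lemmaA'_small m N k (by omega) hmk hk5 hN hk2
  rcases Nat.lt_or_ge (m / 2) k with hjk | hjk
  · exact lemmaA'_regimeII m N k hm hjk hmk hN hk2
  rcases Nat.lt_or_ge k 9 with hk9 | hk9
  · exact lemmaA'_regimeI_small m N k hk5 (by omega) (by omega) hN
  · exact lemmaA'_regimeI m N k hk9 hjk hN

/-- **High-`k` criterion (threshold `2n ≥ 3m+2`).** For `k ≥ 5`, `3m+2 ≤ 2n`, `2k+1 ≤ n`: `S(m,k)·n² ≤ C(n,k+1)²`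
(Lemma A′ with `N = n-1` and `(k+1)·C(n,k+1) = n·C(n-1,k)`); this is `KYSharper.HighKArithmetic` of `Max/KYSharperAllM`.
The hypothesis `5 ≤ m` of that statement is not needed. [folklore] -/
theorem highK_criterion (m n k : ℕ) (hn : 3 * m + 2 ≤ 2 * n) (hk : 5 ≤ k) (hkn : 2 * k + 1 ≤ n) :
    chooseSqSum m k * n ^ 2 ≤ (n.choose (k + 1)) ^ 2 := by
  obtain ⟨N, rfl⟩ : ∃ N, n = N + 1 := ⟨n - 1, by omega⟩
  have hA : chooseSqSum m k * (k + 1) ^ 2 ≤ (N.choose k) ^ 2 := lemmaA' m N k (by omega) (by omega) hk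
  have hid : (N + 1) * N.choose k = (N + 1).choose (k + 1) * (k + 1) := Nat.add_one_mul_choose_eq N k
  refine Nat.le_of_mul_le_mul_right ?_ (pow_pos (Nat.succ_pos k) 2)
  calc chooseSqSum m k * (N + 1) ^ 2 * (k + 1) ^ 2 = chooseSqSum m k * (k + 1) ^ 2 * (N + 1) ^ 2 := by ring
    _ ≤ (N.choose k) ^ 2 * (N + 1) ^ 2 := Nat.mul_le_mul_right _ hA
    _ = ((N + 1) * N.choose k) ^ 2 := by ring
    _ = ((N + 1).choose (k + 1)) ^ 2 * (k + 1) ^ 2 := by rw [hid]; ring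

end KYAllM

end Summit.PneNP.GCT
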